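import Mathlib
import Summits.MatrixMultiplication.MatrixMultiplication.Theorems.GradedDesignFamily.Negative.SL2Generators
import Summits.MatrixMultiplication.MatrixMultiplication.Theorems.GradedDesignFamily.Negative.SubfieldCellSubfield

/-!
# (G) Bounded-index subgroups of `SL₂(k)` are everything
# (crux `LevelGradedCohnUmans.GradedDesignFamily`, stmt-MatrixMultiplication-7610; negative side,
# line `quadratic-extension-level-one-cell`, unit b2b-lgcu-subfield gen 19)

HONEST FRAMING.  An elementary input of route (D′) of the unit (removing the hypothesis (Dickson)
from `not_subfieldCell_of_BGT_Dickson`): for every `M` there is `q₀ = 4M² + 3` such that a subgroup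
`R ≤ SL₂(k)`, `|k| ≥ q₀`, with `|SL₂(k)| ≤ M·|R|` is all of `SL₂(k)`.  Proof: the root set
`A = {x : u_x ∈ R}` is an additive group with `|k| ≤ M|A|` (fibre counting), stable under the squares
of `T = {t : diag(t,t⁻¹) ∈ R}` (`|k| - 1 ≤ M|T|`); its multiplier ring `D = {c : cA ⊆ A}` is a
subfield containing `T²`, and a proper subfield has `|D|² ≤ |k|`, which the sizes forbid; so `D = k`,
`A = k`, and the same for the lower root group after conjugating `R` by the Weyl element; then
`SL₂(k) = ⟨u, l⟩` (`sl2md_decomp`).  A toolkit theorem on the NEGATIVE side of the design stub S3;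
NOT summit progress.

Sorry-free. [folklore]
-/

set_option linter.dupNamespace false

namespace Summit.MatrixMultiplication.MatrixMultiplication.Theorems.GradedDesignFamily.Negative

section BoundedIndex

variable {k : Type} [Field k]

/-- `t_c t_d = t_{cd}`. [folklore] -/
theorem sl2md_diag_mul (c d : kˣ) :
    (⟨_, sl2md_det_diag c⟩ * ⟨_, sl2md_det_diag d⟩ : Matrix.SpecialLinearGroup (Fin 2) k) =
      ⟨_, sl2md_det_diag (c * d)⟩ := by
  refine Matrix.SpecialLinearGroup.ext _ _ fun i j => ?_
  rw [Matrix.SpecialLinearGroup.coe_mul]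
  fin_cases i <;> fin_cases j <;> simp [Matrix.mul_apply, Fin.sum_univ_two, mul_comm]

/-- `t_1 = 1`. [folklore] -/
theorem sl2md_diag_one :
    (⟨_, sl2md_det_diag (1 : kˣ)⟩ : Matrix.SpecialLinearGroup (Fin 2) k) =
      (1 : Matrix.SpecialLinearGroup (Fin 2) k) := by
  refine Matrix.SpecialLinearGroup.ext _ _ fun i j => ?_
  rw [Matrix.SpecialLinearGroup.coe_one]
  fin_cases i <;> fin_cases j <;> simp

/-- `u_x⁻¹ = u_{-x}`. [folklore] -/
theorem sl2md_upper_inv (x : k) :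
    (⟨_, sl2md_det_upper x⟩⁻¹ : Matrix.SpecialLinearGroup (Fin 2) k) = ⟨_, sl2md_det_upper (-x)⟩ := by
  apply inv_eq_of_mul_eq_one_right
  rw [sl2md_upper_mul, add_neg_cancel]
  exact sl2md_upper_zero

/-- `t_c⁻¹ = t_{c⁻¹}`. [folklore] -/
theorem sl2md_diag_inv (c : kˣ) :
    (⟨_, sl2md_det_diag c⟩⁻¹ : Matrix.SpecialLinearGroup (Fin 2) k) = ⟨_, sl2md_det_diag c⁻¹⟩ := by
  apply inv_eq_of_mul_eq_one_right
  rw [sl2md_diag_mul, mul_inv_cancel]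
  exact sl2md_diag_one

variable [Fintype k] [DecidableEq k]

/-- **Fibre counting.**  If `|G| ≤ M·|R|` for a subgroup `R ≤ G` and every fibre
`{y : (f x₀)⁻¹ f y ∈ R}` of `f : X → G` lies in a set of at most `N` elements, then `|X| ≤ M·N`.
[folklore] -/
theorem card_le_of_fibre {G X : Type} [Group G] [Fintype G] [DecidableEq G] [Fintype X]
    [DecidableEq X] (R : Subgroup G) (f : X → G) (M N : ℕ)
    (hR : Fintype.card G ≤ M * Nat.card R)
    (hfib : ∀ x₀ : X, ∃ s : Finset X, s.card ≤ N ∧ ∀ y, (f x₀)⁻¹ * f y ∈ R → y ∈ s) :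
    Fintype.card X ≤ M * N := by
  classical
  set RF : Finset G := Finset.univ.filter (· ∈ R) with hRF
  have hmemRF : ∀ g, g ∈ RF ↔ g ∈ R := fun g => by simp [hRF]
  have hRFcard : Nat.card R = RF.card := Nat.subtype_card RF hmemRF
  have hRpos : 0 < Nat.card R := Nat.card_pos
  set s : Finset (X × G) := Finset.univ ×ˢ RF with hs
  have hscard : s.card = Fintype.card X * Nat.card R := by
    rw [hs, Finset.card_product, Finset.card_univ, hRFcard]
  let F : X × G → G := fun p => f p.1 * p.2
  have hfibre : ∀ a ∈ s.image F, (s.filter fun p => F p = a).card ≤ N := by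
    intro a ha
    obtain ⟨⟨x₀, r₀⟩, hp₀, rfl⟩ := Finset.mem_image.1 ha
    have hr₀ : r₀ ∈ R := (hmemRF _).1 (Finset.mem_product.1 hp₀).2
    obtain ⟨s₀, hs₀, hs₀mem⟩ := hfib x₀
    refine le_trans ?_ hs₀
    refine Finset.card_le_card_of_injOn Prod.fst ?_ ?_
    · intro p hp
      rw [Finset.mem_coe, Finset.mem_filter] at hp
      rw [Finset.mem_coe]
      obtain ⟨hps, hpF⟩ := hp
      have hr : p.2 ∈ R := (hmemRF _).1 (Finset.mem_product.1 hps).2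
      apply hs₀mem
      have hpF' : f p.1 * p.2 = f x₀ * r₀ := hpF
      have e : f p.1 = f x₀ * r₀ * p.2⁻¹ := by rw [← hpF', mul_inv_cancel_right]
      have e' : (f x₀)⁻¹ * f p.1 = r₀ * p.2⁻¹ := by rw [e]; group
      rw [e']
      exact R.mul_mem hr₀ (R.inv_mem hr)
    · rintro ⟨y, r⟩ hp ⟨y', r'⟩ hp' (hyy : y = y')
      rw [Finset.mem_coe, Finset.mem_filter] at hp hp'
      subst hyy
      have h : f y * r = f y * r' := hp.2.trans hp'.2.symm
      rw [mul_left_cancel h]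
  have h1 : s.card ≤ N * (s.image F).card := Finset.card_le_mul_card_image s N hfibre
  have h2 : (s.image F).card ≤ Fintype.card G := Finset.card_le_univ _
  have h3 : Fintype.card X * Nat.card R ≤ (M * N) * Nat.card R := by
    calc Fintype.card X * Nat.card R = s.card := hscard.symm
      _ ≤ N * (s.image F).card := h1
      _ ≤ N * Fintype.card G := Nat.mul_le_mul_left _ h2
      _ ≤ N * (M * Nat.card R) := Nat.mul_le_mul_left _ hR
      _ = (M * N) * Nat.card R := by ring
  exact Nat.le_of_mul_le_mul_right h3 hRpos

/-- `|k| ≤ M · |{x : u_x ∈ R}|` when `|SL₂(k)| ≤ M·|R|`. [folklore] -/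
theorem card_le_mul_card_upperRoot (R : Subgroup (Matrix.SpecialLinearGroup (Fin 2) k)) (M : ℕ)
    (hR : Fintype.card (Matrix.SpecialLinearGroup (Fin 2) k) ≤ M * Nat.card R) (A : Finset k)
    (hA : ∀ y, y ∈ A ↔ ⟨_, sl2md_det_upper y⟩ ∈ R) :
    Fintype.card k ≤ M * A.card := by
  classical
  refine card_le_of_fibre R
    (fun x : k => (⟨_, sl2md_det_upper x⟩ : Matrix.SpecialLinearGroup (Fin 2) k)) M _ hR ?_
  intro x₀
  refine ⟨A.image (· + x₀), Finset.card_image_le, ?_⟩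
  intro y hy
  have h : (⟨_, sl2md_det_upper x₀⟩⁻¹ * ⟨_, sl2md_det_upper y⟩ :
      Matrix.SpecialLinearGroup (Fin 2) k) ∈ R := hy
  rw [sl2md_upper_inv, sl2md_upper_mul, neg_add_eq_sub, ← hA] at h
  exact Finset.mem_image.2 ⟨y - x₀, h, sub_add_cancel y x₀⟩

/-- `|k| - 1 ≤ M · |{t : diag(t, t⁻¹) ∈ R}|` when `|SL₂(k)| ≤ M·|R|`. [folklore] -/
theorem card_le_mul_card_torus (R : Subgroup (Matrix.SpecialLinearGroup (Fin 2) k)) (M : ℕ)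
    (hR : Fintype.card (Matrix.SpecialLinearGroup (Fin 2) k) ≤ M * Nat.card R) (T : Finset kˣ)
    (hT : ∀ t, t ∈ T ↔ ⟨_, sl2md_det_diag t⟩ ∈ R) :
    Fintype.card k - 1 ≤ M * T.card := by
  classical
  rw [← Fintype.card_units]
  refine card_le_of_fibre R
    (fun t : kˣ => (⟨_, sl2md_det_diag t⟩ : Matrix.SpecialLinearGroup (Fin 2) k)) M _ hR ?_
  intro t₀
  refine ⟨T.image (t₀ * ·), Finset.card_image_le, ?_⟩
  intro t ht
  have h : (⟨_, sl2md_det_diag t₀⟩⁻¹ * ⟨_, sl2md_det_diag t⟩ :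
      Matrix.SpecialLinearGroup (Fin 2) k) ∈ R := ht
  rw [sl2md_diag_inv, sl2md_diag_mul, ← hT] at h
  exact Finset.mem_image.2 ⟨t₀⁻¹ * t, h, mul_inv_cancel_left t₀ t⟩

/-- **Upper root group is full.**  If `|k| ≥ 4M² + 3` and `|SL₂(k)| ≤ M·|R|` then every `u_x`
lies in `R`. [folklore] -/
theorem upper_mem_of_card_le (M : ℕ) (hq : 4 * M ^ 2 + 3 ≤ Fintype.card k)
    (R : Subgroup (Matrix.SpecialLinearGroup (Fin 2) k))
    (hR : Fintype.card (Matrix.SpecialLinearGroup (Fin 2) k) ≤ M * Nat.card R) (x : k) :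
    ⟨_, sl2md_det_upper x⟩ ∈ R := by
  classical
  set q := Fintype.card k with hqdef
  set A : Finset k := Finset.univ.filter fun y : k => ⟨_, sl2md_det_upper y⟩ ∈ R with hAdef
  set T : Finset kˣ := Finset.univ.filter fun t : kˣ => ⟨_, sl2md_det_diag t⟩ ∈ R with hTdef
  have memA : ∀ y, y ∈ A ↔ ⟨_, sl2md_det_upper y⟩ ∈ R := fun y => by simp [hAdef]
  have memT : ∀ t, t ∈ T ↔ ⟨_, sl2md_det_diag t⟩ ∈ R := fun t => by simp [hTdef]
  have hA : q ≤ M * A.card := card_le_mul_card_upperRoot R M hR A memA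
  have hT : q - 1 ≤ M * T.card := card_le_mul_card_torus R M hR T memT
  -- `A` is an additive group stable under the squares of `T`
  have hA0 : (0 : k) ∈ A := by rw [memA, sl2md_upper_zero]; exact R.one_mem
  have hAadd : ∀ a ∈ A, ∀ b ∈ A, a + b ∈ A := by
    intro a ha b hb
    rw [memA] at ha hb ⊢
    rw [← sl2md_upper_mul]
    exact R.mul_mem ha hb
  have hAneg : ∀ a ∈ A, -a ∈ A := by
    intro a ha
    rw [memA] at ha ⊢
    rw [← sl2md_upper_inv]
    exact R.inv_mem ha
  have hAT : ∀ t ∈ T, ∀ a ∈ A, (t : k) ^ 2 * a ∈ A := by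
    intro t ht a ha
    rw [memT] at ht
    rw [memA] at ha ⊢
    have e : (⟨_, sl2md_det_diag t⟩ * ⟨_, sl2md_det_upper a⟩ * ⟨_, sl2md_det_diag t⟩⁻¹ :
        Matrix.SpecialLinearGroup (Fin 2) k) = ⟨_, sl2md_det_upper ((t : k) ^ 2 * a)⟩ := by
      rw [mul_inv_eq_iff_eq_mul, sl2md_diag_mul_upper, sq]
    rw [← e]
    exact R.mul_mem (R.mul_mem ht ha) (R.inv_mem ht)
  -- the multiplier set `D`
  set D : Finset k := Finset.univ.filter fun c : k => ∀ a ∈ A, c * a ∈ A with hDdef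
  have memD : ∀ c, c ∈ D ↔ ∀ a ∈ A, c * a ∈ A := fun c => by simp [hDdef]
  have hDadd : ∀ c ∈ D, ∀ d ∈ D, c + d ∈ D := by
    intro c hc d hd
    rw [memD] at hc hd ⊢
    intro a ha
    rw [add_mul]
    exact hAadd _ (hc a ha) _ (hd a ha)
  have hDneg : ∀ c ∈ D, -c ∈ D := by
    intro c hc
    rw [memD] at hc ⊢
    intro a ha
    rw [neg_mul]
    exact hAneg _ (hc a ha)
  have hDsub : ∀ c ∈ D, ∀ d ∈ D, c - d ∈ D := by
    intro c hc d hd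
    rw [sub_eq_add_neg]
    exact hDadd c hc _ (hDneg d hd)
  have hDmul : ∀ c ∈ D, ∀ d ∈ D, c * d ∈ D := by
    intro c hc d hd
    rw [memD] at hc hd ⊢
    intro a ha
    rw [mul_assoc]
    exact hc _ (hd a ha)
  have hDinv : ∀ c ∈ D, c ≠ 0 → c⁻¹ ∈ D := by
    intro c hc hc0
    rw [memD] at hc ⊢
    -- `c • A = A`
    have himg : A.image (fun a => c * a) = A := by
      apply Finset.eq_of_subset_of_card_le
      · intro y hy
        obtain ⟨a, ha, rfl⟩ := Finset.mem_image.1 hy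
        exact hc a ha
      · rw [Finset.card_image_of_injective _ (mul_right_injective₀ hc0)]
    intro a ha
    rw [← himg] at ha
    obtain ⟨b, hb, rfl⟩ := Finset.mem_image.1 ha
    rwa [inv_mul_cancel_left₀ hc0]
  have hTD : ∀ t ∈ T, (t : k) ^ 2 ∈ D := by
    intro t ht
    rw [memD]
    exact hAT t ht
  -- sizes: `M < q`, so `A` has a non-zero element
  have hMq : M < q := by nlinarith [hq]
  have hAcard : 1 < A.card := by
    by_contra h
    rw [not_lt] at h
    have := hA.trans (Nat.mul_le_mul_left M h)
    omega
  obtain ⟨a₀, ha₀, ha₀0⟩ : ∃ a₀ ∈ A, a₀ ≠ 0 := by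
    obtain ⟨a, ha, b, hb, hab⟩ := Finset.one_lt_card.1 hAcard
    by_cases ha0 : a = 0
    · exact ⟨b, hb, fun hb0 => hab (ha0.trans hb0.symm)⟩
    · exact ⟨a, ha, ha0⟩
  -- `D` is everything
  have hDuniv : D = Finset.univ := by
    by_contra hne
    obtain ⟨e, he⟩ : ∃ e, e ∉ D := by
      by_contra h
      push Not at h
      exact hne (Finset.eq_univ_of_forall h)
    -- `(c, d) ↦ c + d e` is injective on `D × D`
    have hDD : D.card * D.card ≤ q := by
      have h := Finset.card_le_card_of_injOn (fun p : k × k => p.1 + p.2 * e) (s := D ×ˢ D)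
        (t := Finset.univ) (fun p _ => Finset.mem_coe.2 (Finset.mem_univ _)) ?_
      · rwa [Finset.card_product, Finset.card_univ] at h
      rintro ⟨c, d⟩ hcd ⟨c', d'⟩ hcd' h
      rw [Finset.mem_coe, Finset.mem_product] at hcd hcd'
      dsimp only at h hcd hcd'
      by_cases hd : d = d'
      · subst hd
        have hc : c = c' := add_right_cancel h
        rw [hc]
      · exfalso
        apply he
        have hd' : d - d' ≠ 0 := sub_ne_zero.2 hd
        have he' : e = (c' - c) * (d - d')⁻¹ := by
          rw [eq_mul_inv_iff_mul_eq₀ hd']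
          linear_combination h
        rw [he']
        exact hDmul _ (hDsub _ hcd'.1 _ hcd.1) _ (hDinv _ (hDsub _ hcd.2 _ hcd'.2) hd')
    -- `|T| ≤ 2 |D|`
    have hT2 : T.card ≤ 2 * D.card := by
      have h1 : (T.image (fun t : kˣ => (t : k))).card = T.card :=
        Finset.card_image_of_injective _ Units.val_injective
      have h2 := card_le_two_mul_card_image_sq (T.image (fun t : kˣ => (t : k)))
      have h3 : ((T.image (fun t : kˣ => (t : k))).image (fun m => m ^ 2)) ⊆ D := by
        intro c hc
        rw [Finset.mem_image] at hc
        obtain ⟨m, hm, rfl⟩ := hc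
        rw [Finset.mem_image] at hm
        obtain ⟨t, ht, rfl⟩ := hm
        exact hTD t ht
      calc T.card = (T.image (fun t : kˣ => (t : k))).card := h1.symm
        _ ≤ 2 * ((T.image (fun t : kˣ => (t : k))).image (fun m => m ^ 2)).card := h2
        _ ≤ 2 * D.card := Nat.mul_le_mul_left 2 (Finset.card_le_card h3)
    -- arithmetic
    have hT' : q ≤ M * T.card + 1 := by omega
    have e0 : q ≤ 2 * M * D.card + 1 := by nlinarith [hT', Nat.mul_le_mul_left M hT2]
    have e1 : 4 * M * M * (D.card * D.card) ≤ 4 * M * M * q := Nat.mul_le_mul_left _ hDD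
    have e2 : 4 * M * M * q + 3 * q ≤ q * q := by nlinarith [hq]
    have e3 : (2 * M * D.card) * (2 * M * D.card) < q * q := by nlinarith [e1, e2]
    have e4 : 2 * M * D.card < q := Nat.mul_self_lt_mul_self_iff.1 e3
    have e5 : q * q ≤ (2 * M * D.card + 1) * (2 * M * D.card + 1) := Nat.mul_le_mul e0 e0
    nlinarith [e1, e2, e4, e5]
  -- hence `A = k`
  have hAuniv : ∀ y, y ∈ A := by
    intro y
    have hy : y * a₀⁻¹ ∈ D := by rw [hDuniv]; exact Finset.mem_univ _
    have := (memD _).1 hy a₀ ha₀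
    rwa [inv_mul_cancel_right₀ ha₀0] at this
  exact (memA x).1 (hAuniv x)

end BoundedIndex

/-- **(G) bounded index ⟹ everything.**  For every `M` there is `q₀` (`= 4M² + 3`) such that for
every finite field `k` with `|k| ≥ q₀`, a subgroup `R ≤ SL₂(k)` with `|SL₂(k)| ≤ M·|R|` is all of
`SL₂(k)`.  NOT summit progress. [folklore] -/
theorem subfieldCell_boundedIndex (M : ℕ) :
    ∃ q₀ : ℕ, ∀ (k : Type) [Field k] [Fintype k] [DecidableEq k], q₀ ≤ Fintype.card k →
      ∀ R : Subgroup (Matrix.SpecialLinearGroup (Fin 2) k),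
        Fintype.card (Matrix.SpecialLinearGroup (Fin 2) k) ≤ M * Nat.card R → R = ⊤ := by
  refine ⟨4 * M ^ 2 + 3, ?_⟩
  intro k _ _ _ hq R hR
  classical
  have hu : ∀ x : k, ⟨_, sl2md_det_upper x⟩ ∈ R := fun x => upper_mem_of_card_le M hq R hR x
  set R₂ : Subgroup (Matrix.SpecialLinearGroup (Fin 2) k) :=
    R.map (MulAut.conj (⟨_, sl2md_det_weyl⟩⁻¹ : Matrix.SpecialLinearGroup (Fin 2) k)).toMonoidHom
    with hR₂def
  have hR₂ : Fintype.card (Matrix.SpecialLinearGroup (Fin 2) k) ≤ M * Nat.card R₂ := by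
    rw [hR₂def, Subgroup.card_map_of_injective
      (MulAut.conj (⟨_, sl2md_det_weyl⟩⁻¹ : Matrix.SpecialLinearGroup (Fin 2) k)).injective]
    exact hR
  have hu₂ : ∀ x : k, ⟨_, sl2md_det_upper x⟩ ∈ R₂ := fun x => upper_mem_of_card_le M hq R₂ hR₂ x
  have hl : ∀ x : k, ⟨_, sl2md_det_lower x⟩ ∈ R := by
    intro x
    have h := hu₂ (-x)
    rw [hR₂def, Subgroup.mem_map_equiv, MulAut.conj_symm_apply, inv_inv, sl2md_weyl_mul_upper,
      mul_inv_cancel_right] at h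
    exact h
  rw [Subgroup.eq_top_iff']
  intro g
  obtain ⟨a, b, c, d, rfl⟩ := sl2md_decomp g
  exact R.mul_mem (R.mul_mem (R.mul_mem (hu a) (hl c)) (hu b)) (hl d)

end Summit.MatrixMultiplication.MatrixMultiplication.Theorems.GradedDesignFamily.Negative
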